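import Summits.CriticalPhenomena.PercolationContinuityZ3.Theorems.PercNearOneGluingNoHeavyQuantCatHullCertificate
import Summits.CriticalPhenomena.PercolationContinuityZ3.Theorems.PercNearOneGluingNoHeavyQuantCatHullShiftCheck2
import HarnessLib

/-!
# QUANT lane R8, T-DEC: THE CERTIFICATE CHECKER FOR THE LIGHT CORNER, CORRECTED STRUCTURAL PART — `CertData.check2` (complete shift check `shiftOK2`,
# `A`-range condition `10 − u ≤` last breakpoint so that the offset-10 table can be well-formed) and its soundness: a passing certificate EXCLUDES `lpT 4 (17/25) (499/680)` from `InGatedCatHull (997/2000) (669/125) 10`, hence refutes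
# `TreeBuiltCatHullLight` and `CatPairLight`

builds on p205010 (kernel theorem, internal audit signed; external expert review pending)

Support file (`--supports stmt-CriticalPhenomena-4575`), QUANT lane census seat prim-quant-census-2 (gen 78).  Definitions + theorems; standard axioms,
no sorries; NO data here.  `CertData.check` of `…QuantCatHullCertificate` is unsatisfiable as typed (for `u = 10` it asks the last `A`-breakpoint to be `0`
while `Tab.wf` asks the first cell to be nondegenerate) and its shift check tests points outside the polygon; `CertData.check2 D` repairs both and runs: well-formedness of the eleven offset tables
(shared `G`-grid from `y = 997/2000` to `1`, `A`-range `[0, 10−u]`), nonnegative slopes and the tip check at offsets in `S = {0,1,2,5,6,10}`, the exact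
shift check between consecutive offsets, the exact leaf checks for the 30 admissible `(u, a)` pairs (kinds read off `CertData.leafList`, whose
correctness `CertData.kind_spec` is decided in the kernel), and the final strict inequality `ψ 0 + Z₀(1, T) < Σ ψ(h)·lpT(h)`.  `CertData.valueBound`:
`check = true ⟹ CatValueBoundS S ψ y 10 Z`; `CertData.not_mem`: `⟹ lpT 4 (17/25) (499/680) ∉ InGatedCatHull (997/2000) (669/125) 10`;
`CertData.not_treeBuiltCatHullLight` / `CertData.not_catPairLight` via `lpT_inGatedCatHull_of_treeBuiltCatHullLight` / `…_of_catPairLight`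
(floor `997/2000 < qs = 499/1000 < 1/2`).  Instance: census-2 g78 (kit margin scan j274656: the B&B margin at this corner is 9.0e-3, 3.3× the g77 corner's).
[this work].  Nothing here is cited as a published result.  The gluing rows served [cite: KozmaNitzan2024, Conjecture 3 (p. 15)]; product measure
[cite: Grimmett1999, §1.3 p. 10].
-/

noncomputable section

open scoped BigOperators

namespace Summit.CriticalPhenomena.PercolationContinuityZ3.Theorems
namespace Quant
namespace LawDec

open Finset Tab

namespace CertData

/-- structural checks of the eleven tables + monotonicity/tip on `S` + the exact shift check between consecutive offsets. [this work] -/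
def structChecks2 (D : CertData) : Bool :=
  decide (0 < D.y) && decide (D.y < 1) &&
  ((List.range 11).all fun u => (D.Tu u).wf && decide ((D.Tu u).gb.getD 0 0 = D.y) && decide ((D.Tu u).gb.getLast?.getD 0 = 1) &&
      decide (10 - (u : ℚ) ≤ (D.Tu u).ab.getLast?.getD 0)) &&
  ([0, 1, 2, 5, 6, 10].all fun u => (D.Tu u).slopesOK && (D.Tu u).tipOK) &&
  ((List.range 10).all fun u => shiftOK2 (D.Tu u) (D.Tu (u + 1)) 1 (D.ψq (u + 1) - D.ψq u))

/-! ### Soundness: the value bound -/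

/-- table facts from the structural checks. [this work] -/
theorem struct_wf2 {D : CertData} (h : D.structChecks2 = true) {u : ℕ} (hu : u < 11) :
    (D.Tu u).wf = true ∧ (D.Tu u).gb.getD 0 0 = D.y ∧ (D.Tu u).gb.getLast?.getD 0 = 1 ∧ 10 - (u : ℚ) ≤ (D.Tu u).ab.getLast?.getD 0 := by
  unfold structChecks2 at h
  simp only [Bool.and_eq_true, decide_eq_true_eq, List.all_eq_true] at h
  obtain ⟨⟨⟨_, hall⟩, _⟩, _⟩ := h
  have := hall u (List.mem_range.2 hu)
  exact ⟨this.1.1.1, this.1.1.2, this.1.2, this.2⟩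

/-- one consecutive shift step. [this work] -/
theorem shift_step2 {D : CertData} (hs : D.structChecks2 = true) {v : ℕ} (hv : v + 1 ≤ 10) {G A : ℝ} (hyG : (D.y : ℝ) < G) (hG1 : G ≤ 1)
    (hA0 : 0 ≤ A) (hA1 : A ≤ G * (10 - ((v + 1 : ℕ) : ℝ))) :
    D.Z (v + 1) G A + G * (D.ψ (v + 1) - D.ψ v) ≤ D.Z v G (A + G) := by
  have hs' := hs
  unfold structChecks2 at hs'
  simp only [Bool.and_eq_true, decide_eq_true_eq, List.all_eq_true] at hs'
  obtain ⟨⟨⟨⟨hy0, _⟩, _⟩, _⟩, hsh⟩ := hs'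
  obtain ⟨hw, hg0, hg1, hab⟩ := struct_wf2 hs (by omega : v < 11)
  obtain ⟨hw', hg0', hg1', hab'⟩ := struct_wf2 hs (by omega : v + 1 < 11)
  have hchk := hsh v (List.mem_range.2 (by omega))
  have hyp : (0:ℝ) < D.y := by exact_mod_cast hy0
  have hG0 : 0 ≤ G := by linarith
  have hv' : (v : ℝ) + 1 ≤ 10 := by exact_mod_cast hv
  have hA1' : A ≤ G * (10 - ((v : ℝ) + 1)) := by push_cast at hA1; exact hA1
  have hGle : G * (10 - ((v : ℝ) + 1)) ≤ 10 - ((v : ℝ) + 1) := by nlinarith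
  have ha0 : (((D.Tu (v + 1)).ab.getD 0 0 : ℚ) : ℝ) ≤ A := by rw [ab0_of_wf hw']; simpa using hA0
  have ha1 : A ≤ (((D.Tu (v + 1)).ab.getLast?.getD 0 : ℚ) : ℝ) := by
    have : ((10 - ((v + 1 : ℕ) : ℚ) : ℚ) : ℝ) ≤ (((D.Tu (v + 1)).ab.getLast?.getD 0 : ℚ) : ℝ) := by exact_mod_cast hab'
    push_cast at this; linarith [hA1', hGle]
  have hb0 : (((D.Tu v).ab.getD 0 0 : ℚ) : ℝ) ≤ A + G * ((1 : ℕ) : ℝ) := by rw [ab0_of_wf hw]; push_cast; nlinarith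
  have hb1 : A + G * ((1 : ℕ) : ℝ) ≤ (((D.Tu v).ab.getLast?.getD 0 : ℚ) : ℝ) := by
    have : ((10 - (v : ℚ) : ℚ) : ℝ) ≤ (((D.Tu v).ab.getLast?.getD 0 : ℚ) : ℝ) := by exact_mod_cast hab
    have hGle2 : G * (10 - (v : ℝ)) ≤ 10 - (v : ℝ) := mul_le_of_le_one_left (by linarith) hG1
    have e : G * (10 - ((v : ℝ) + 1)) + G * ((1 : ℕ) : ℝ) = G * (10 - (v : ℝ)) := by push_cast; ring
    push_cast at this; linarith
  have key := shift_sound2 (Ts := D.Tu v) (Ts' := D.Tu (v + 1)) (δ := 1) (dψ := D.ψq (v + 1) - D.ψq v) hchk Nat.one_pos hw hw' (G := G) (A := A)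
    (by rw [hg0']; exact hyG.le) (by rw [hg1']; exact_mod_cast hG1) ha0 ha1 hb0 hb1
  unfold Z ψ
  push_cast at key ⊢
  simpa using key

/-- all shifts, by chaining consecutive steps. [this work] -/
theorem shift_all2 {D : CertData} (hs : D.structChecks2 = true) :
    ∀ (b u : ℕ) (G A : ℝ), (D.y : ℝ) < G → G ≤ 1 → 0 ≤ A → A ≤ G * (10 - ((u + (b + 1) : ℕ) : ℝ)) →
      D.Z (u + (b + 1)) G A + G * (D.ψ (u + (b + 1)) - D.ψ u) ≤ D.Z u G (A + G * ((b + 1 : ℕ) : ℝ))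
  | 0, u, G, A, hyG, hG1, hA0, hAB => by
    have hu : u + 1 ≤ 10 := by
      by_contra hc; push Not at hc
      have : (10 : ℝ) - ((u + (0 + 1) : ℕ) : ℝ) < 0 := by
        have : (10 : ℝ) < ((u + (0 + 1) : ℕ) : ℝ) := by exact_mod_cast (by omega : 10 < u + (0 + 1))
        linarith
      have hG : 0 < G := by
        have hs' := hs; unfold structChecks2 at hs'; simp only [Bool.and_eq_true, decide_eq_true_eq] at hs'
        have : (0:ℝ) < D.y := by exact_mod_cast hs'.1.1.1.1
        linarith
      nlinarith
    have := shift_step2 hs hu hyG hG1 hA0 (by simpa using hAB)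
    simpa using this
  | b + 1, u, G, A, hyG, hG1, hA0, hAB => by
    have hs' := hs; unfold structChecks2 at hs'; simp only [Bool.and_eq_true, decide_eq_true_eq] at hs'
    have hyp : (0:ℝ) < D.y := by exact_mod_cast hs'.1.1.1.1
    have hG : 0 < G := by linarith
    have hub : u + (b + 2) ≤ 10 := by
      by_contra hc; push Not at hc
      have : (10 : ℝ) - ((u + (b + 1 + 1) : ℕ) : ℝ) < 0 := by
        have : (10 : ℝ) < ((u + (b + 1 + 1) : ℕ) : ℝ) := by exact_mod_cast (by omega : 10 < u + (b + 1 + 1))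
        linarith
      nlinarith
    -- inner step at offset u + (b+1)
    have e1 : u + (b + 1 + 1) = (u + (b + 1)) + 1 := by ring
    have s1 := shift_step2 hs (v := u + (b + 1)) (by omega) hyG hG1 hA0 (by rw [← e1]; exact hAB)
    -- IH from offset u + (b+1) down to u, at A + G
    have hAB' : A + G ≤ G * (10 - ((u + (b + 1) : ℕ) : ℝ)) := by push_cast at hAB ⊢; nlinarith
    have s2 := shift_all2 hs b u G (A + G) hyG hG1 (by nlinarith) hAB'
    rw [e1]
    have e3 : A + G * ((b + 1 + 1 : ℕ) : ℝ) = A + G + G * ((b + 1 : ℕ) : ℝ) := by push_cast; ring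
    rw [e3]
    have e4 : D.ψ (u + (b + 1) + 1) - D.ψ u = (D.ψ (u + (b + 1) + 1) - D.ψ (u + (b + 1))) + (D.ψ (u + (b + 1)) - D.ψ u) := by ring
    rw [e4, mul_add]
    linarith

/-- **SOUNDNESS: a passing certificate is an offset value bound.** [this work] -/
theorem valueBound2 (D : CertData) (hs : D.structChecks2 = true) (hl : D.leafChecks = true) : CatValueBoundS S D.ψ (D.y : ℝ) 10 D.Z := by
  have hs' := hs
  unfold structChecks2 at hs'
  simp only [Bool.and_eq_true, decide_eq_true_eq, List.all_eq_true] at hs'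
  obtain ⟨⟨⟨⟨hy0, hy1⟩, hall⟩, hS⟩, hsh⟩ := hs'
  have hyR : (0 : ℝ) < D.y := by exact_mod_cast hy0
  refine ⟨?_, ?_, ?_, ?_⟩
  · -- tip
    intro u hu G hyG hG1
    have hu11 : u < 11 := by unfold S at hu; simp at hu; omega
    obtain ⟨hw, hg0, _, _⟩ := struct_wf2 hs hu11
    have hmem : u ∈ [0, 1, 2, 5, 6, 10] := by unfold S at hu; simpa using hu
    obtain ⟨_, htip⟩ := hS u hmem
    have hle : (((D.Tu u).gb.getD 0 0 : ℚ) : ℝ) ≤ G := by rw [hg0]; exact hyG.le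
    exact Z_tip hw htip hle
  · -- mono (u ∈ S)
    intro u hu G G' A _ hGG' _ _ _
    have hmem : u ∈ [0, 1, 2, 5, 6, 10] := by unfold S at hu; simpa using hu
    obtain ⟨hsl, _⟩ := hS u hmem
    exact Z_mono hsl hGG' A
  · -- shift
    intro u a G A ha hyG hG1 hA0 hAB
    obtain ⟨b, rfl⟩ : ∃ b, a = b + 1 := ⟨a - 1, by omega⟩
    exact shift_all2 hs b u G A hyG hG1 hA0 hAB
  · -- leaf
    intro u a G g x N ν ha hyG hG1 hGx hxg hgl hcat hsupp
    obtain ⟨f0, fN, f1, _⟩ := hcat.lawFacts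
    have hx1 : x < 1 := hcat.floor.2
    have hG : 0 < G := hyR.trans hyG
    have hne : ∃ k, ν k ≠ 0 := by
      by_contra hc; push Not at hc
      exact law_supp_nonempty fN f1 fun k hk => hk (hc k)
    obtain ⟨k₀, hk₀⟩ := hne
    have memS : ∀ {n : ℕ}, n ∈ S → n ≤ 10 := by intro n hn; unfold S at hn; simp at hn; omega
    have hu : u < 11 := by have := memS (hsupp k₀ hk₀).1; omega
    have ha11 : a < 11 := by have := memS (hsupp k₀ hk₀).2; omega
    have clause : ∀ k, ν k ≠ 0 → kindClause u a k := fun k hk =>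
      kind_spec hu ha11 ha (by have := memS (hsupp k hk).1; omega) (hsupp k hk).1 (hsupp k hk).2
    obtain ⟨tw, tg0, tg1, tab⟩ := struct_wf2 hs hu
    unfold leafChecks at hl; rw [List.all_eq_true] at hl
    -- membership of the entry (u, a, kindOf u a)
    have hfind : (kindOf u a).1 ≠ 0 → (u, a, (kindOf u a).1, (kindOf u a).2) ∈ leafList := by
      intro hc0
      unfold kindOf at hc0 ⊢
      cases hf : (leafList.find? fun e => e.1 = u ∧ e.2.1 = a) with
      | none => exfalso; apply hc0; rw [hf]; rfl
      | some e =>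
        have hm := List.mem_of_find?_eq_some hf
        have hp := List.find?_some hf
        simp only [decide_eq_true_eq] at hp
        rcases e with ⟨e1, e2, e3, e4⟩
        simp only at hp
        obtain ⟨rfl, rfl⟩ := hp
        simpa using hm
    -- bound on the absolute mean from a bound on the atoms
    have hAof : ∀ (m : ℕ), (∀ k, ν k ≠ 0 → k ≤ m) → u + a + m ≤ 10 → G * (lmean N ν + a * g) ≤ (((D.Tu u).ab.getLast?.getD 0 : ℚ) : ℝ) := by
      intro m hm hum
      have htab : ((10 - (u : ℚ) : ℚ) : ℝ) ≤ (((D.Tu u).ab.getLast?.getD 0 : ℚ) : ℝ) := by exact_mod_cast tab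
      push_cast at htab
      refine le_trans ?_ htab
      have hlm : lmean N ν ≤ m := by
        unfold lmean
        calc ∑ h ∈ Finset.range (N + 1), (h : ℝ) * ν h ≤ ∑ h ∈ Finset.range (N + 1), (m : ℝ) * ν h := by
              refine Finset.sum_le_sum fun h _ => ?_
              by_cases hz : ν h = 0
              · rw [hz, mul_zero, mul_zero]
              · exact mul_le_mul_of_nonneg_right (by exact_mod_cast hm h hz) (f0 h)
          _ = m := by rw [← Finset.mul_sum, f1, mul_one]
      have hg0' : 0 ≤ g := le_trans hcat.floor.1.le hxg
      have h1 : lmean N ν + a * g ≤ (m : ℝ) + a := by nlinarith [(Nat.cast_nonneg a : (0:ℝ) ≤ a), hgl.le]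
      have h2 : ((m : ℝ) + a) ≤ 10 - u := by
        have : ((u + a + m : ℕ) : ℝ) ≤ 10 := by exact_mod_cast hum
        push_cast at this; linarith
      have h3 : 0 ≤ lmean N ν + a * g := add_nonneg (lmean_nonneg f0) (mul_nonneg (Nat.cast_nonneg a) hg0')
      nlinarith
    rcases clause k₀ hk₀ with ⟨hc1, _, hsum⟩ | ⟨hc2, _, hsum⟩ | ⟨hc3, _, hsum⟩ | ⟨hc4, _, hsum⟩
    · -- one atom d
      have hsf : ∀ k, ν k ≠ 0 → k = (kindOf u a).2 := fun k hk => by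
        rcases clause k hk with ⟨_, h, _⟩ | ⟨h, _⟩ | ⟨h, _⟩ | ⟨h, _⟩ <;> first | exact h | (exfalso; omega)
      have hchk := hl _ (hfind (by omega))
      simp only [hc1] at hchk; norm_num at hchk
      exact leaf_one D.ψq D.y (D.Tu u) D.fuel u a (kindOf u a).2 hchk tw tg0 tg1 f0 fN f1 hsf (x := x) hy0 hyG hG1 hGx hx1 hxg hgl
        (hAof _ (fun k hk => (hsf k hk).le) hsum)
    · -- atoms {0,4}
      have hsf : ∀ k, ν k ≠ 0 → k = 0 ∨ k = 4 := fun k hk => by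
        rcases clause k hk with ⟨h, _⟩ | ⟨_, h, _⟩ | ⟨h, _⟩ | ⟨h, _⟩ <;> first | exact h | (exfalso; omega)
      have hchk := hl _ (hfind (by omega))
      simp only [hc2] at hchk; norm_num at hchk
      have hreg := catBuilt_supp04 hcat hsf
      exact leaf_two D.ψq D.y (D.Tu u) D.fuel u a hchk.1 hchk.2 tw tg0 tg1 f0 fN f1 hsf hreg hy0 hyG hG1 hGx hx1 hxg hgl
        (hAof 4 (fun k hk => by rcases hsf k hk with h | h <;> omega) hsum)
    · -- atoms {0,1,5}
      have hsf : ∀ k, ν k ≠ 0 → k = 0 ∨ k = 1 ∨ k = 5 := fun k hk => by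
        rcases clause k hk with ⟨h, _⟩ | ⟨h, _⟩ | ⟨_, h, _⟩ | ⟨h, _⟩ <;> first | exact h | (exfalso; omega)
      have hchk := hl _ (hfind (by omega))
      simp only [hc3] at hchk; norm_num at hchk
      have hreg := catBuilt_supp015 hcat hsf
      exact leaf_three D.ψq D.y (D.Tu u) D.fuel u a 0 1 5 hchk.1.1 (fun _ => hchk.1.2) (fun _ => hchk.2) tw tg0 tg1 (by norm_num)
        (by norm_num) (by norm_num) f0 fN f1 hsf hreg hy0 hyG hG1 hGx hx1 hxg hgl
        (hAof 5 (fun k hk => by rcases hsf k hk with h | h | h <;> omega) hsum)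
    · -- atoms {1,2,6}
      have hsf : ∀ k, ν k ≠ 0 → k = 1 ∨ k = 2 ∨ k = 6 := fun k hk => by
        rcases clause k hk with ⟨h, _⟩ | ⟨h, _⟩ | ⟨h, _⟩ | ⟨_, h, _⟩ <;> first | exact h | (exfalso; omega)
      have hchk := hl _ (hfind (by omega))
      simp only [hc4] at hchk; norm_num at hchk
      have hreg := catBuilt_supp126 hcat hsf
      exact leaf_three D.ψq D.y (D.Tu u) D.fuel u a 1 2 6 hchk.1.1 (fun _ => hchk.1.2) (fun _ => hchk.2) tw tg0 tg1 (by norm_num)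
        (by norm_num) (by norm_num) f0 fN f1 hsf hreg hy0 hyG hG1 hGx hx1 hxg hgl
        (hAof 6 (fun k hk => by rcases hsf k hk with h | h | h <;> omega) hsum)

/-- the final strict inequality and the instance constants (same as `finalOK`). [this work] -/
def finalOK2 (D : CertData) : Bool :=
  decide (D.y = 997 / 2000) && decide (D.ψq 0 + (D.Tu 0).ZQ 1 (669 / 125) < ∑ h ∈ Finset.range 11, D.ψq h * lpTq h)

/-- **the complete check (corrected).** [this work] -/
def check2 (D : CertData) : Bool := D.structChecks2 && D.leafChecks && D.finalOK2

/-- **SOUNDNESS OF THE CERTIFICATE: the light glued pair at the new corner is OUTSIDE the gated caterpillar hull at floor `997/2000`.** [this work] -/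
theorem not_mem2 (D : CertData) (h : D.check2 = true) : ¬ InGatedCatHull (997 / 2000 : ℝ) (669 / 125) 10 (lpT 4 (17 / 25) (499 / 680)) := by
  unfold check2 at h; simp only [Bool.and_eq_true] at h
  obtain ⟨⟨hs, hl⟩, hf⟩ := h
  unfold finalOK2 at hf; simp only [Bool.and_eq_true, decide_eq_true_eq] at hf
  obtain ⟨hy, hsep⟩ := hf
  have hyR : (0 : ℝ) < D.y := by rw [hy]; norm_num
  have hV := valueBound2 D hs hl
  have hB : ∀ s ∈ S, (s : ℝ) ≤ 10 := by intro s hs'; unfold S at hs'; simp at hs'; rcases hs' with rfl | rfl | rfl | rfl | rfl | rfl <;> norm_num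
  have key := not_inGatedCatHull_of_valueBoundS hV hyR hB (T := 669 / 125) (M := 10) (μ₀ := lpT 4 (17 / 25) (499 / 680)) lpT_supp ?_
  · have e : ((D.y : ℚ) : ℝ) = 997 / 2000 := by rw [hy]; norm_num
    rwa [e] at key
  · -- the separation, transported from ℚ
    have hZ : D.Z 0 1 (669 / 125) = (((D.Tu 0).ZQ 1 (669 / 125) : ℚ) : ℝ) := by
      have := Z_cast (D.Tu 0) 1 (669 / 125); push_cast at this; exact this
    have hsum : ∑ h ∈ Finset.range (10 + 1), D.ψ h * lpT 4 (17 / 25) (499 / 680) h = ((∑ h ∈ Finset.range 11, D.ψq h * lpTq h : ℚ) : ℝ) := by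
      push_cast; refine Finset.sum_congr rfl fun h _ => ?_; rw [lpT_val]; rfl
    rw [hsum, hZ]; unfold ψ; exact_mod_cast hsep

/-- **¬ `TreeBuiltCatHullLight`** from a passing certificate: the node predicts membership of `lpT 4 (17/25) (499/680)` (tree-built at every floor below
`qs = 499/1000`) at the light floor `997/2000`. [this work] -/
theorem not_treeBuiltCatHullLight2 (D : CertData) (h : D.check2 = true) : ¬ TreeBuiltCatHullLight := by
  intro hL
  have key := lpT_inGatedCatHull_of_treeBuiltCatHullLight hL 4 (17 / 25) (499 / 680) (997 / 2000) (by norm_num) (by norm_num) (by norm_num)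
    (by norm_num) (by norm_num) (by norm_num)
  have e : 2 * (17 / 25 : ℝ) * (1 + (4 : ℕ) * (499 / 680 : ℝ)) = 669 / 125 := by norm_num
  rw [e] at key
  exact not_mem2 D h key

/-- **¬ `CatPairLight`** from a passing certificate: (P) predicts membership at every light floor `≤ qs`, in particular at `997/2000`. [this work] -/
theorem not_catPairLight2 (D : CertData) (h : D.check2 = true) : ¬ CatPairLight := by
  intro hP
  have key := lpT_inGatedCatHull_of_catPairLight hP 4 (17 / 25) (499 / 680) (997 / 2000) (by norm_num) (by norm_num) (by norm_num) (by norm_num)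
    (by norm_num) (by norm_num)
  have e : 2 * (17 / 25 : ℝ) * (1 + (4 : ℕ) * (499 / 680 : ℝ)) = 669 / 125 := by norm_num
  rw [e] at key
  exact not_mem2 D h key

end CertData

end LawDec
end Quant
end Summit.CriticalPhenomena.PercolationContinuityZ3.Theorems
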